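import Mathlib
import HarnessLib
import Literature.MathematicalPhysics.QuantumFieldTheory.WilsonPlaquetteWeakCouplingFloor
import Summits.Ventures.LatticeQCDFlow.Scaling.AutoregressiveGaugePlaquetteTVFloorAnyLink
import Summits.Ventures.LatticeQCDFlow.Scaling.AutoregressiveGaugeKLExtensiveStepFloor

/-!
# LatticeQCDFlow / Scaling — THE VOLUME LAW AT EVERY COUPLING, ALL PLAQUETTE ORIENTATIONS COUNTED: in
# every generation order of all links an endpoint-blind autoregressive gauge model has training loss
# `≥ (d·#sites/4)·w²/2` and drives an exact sampler with `τ_int(sign) ≥ exp((d·#sites/4)·w²/2) − ½`,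
# `1/κ ≥ exp((d·#sites/4)·w²/2)`, `w` any common lower bound of the plaquette means `⟨(1/N)Re tr U_p⟩_β`

HONEST FRAMING: exact (Metropolis-corrected) sampling algorithms for lattice gauge theory;
figures of merit are autocorrelation/cost numbers at stated couplings and volumes; no
continuum-physics claim.

Venture `LatticeQCDFlow` (cell pub-lqcd), topic `Scaling`, FANOUT row 30 (lean-1, GEN-21) — OUR WORK on
THEORY-2.md §4 row C5: the PLAQUETTE-MEAN INSTANCE of `Scaling/AutoregressiveGaugeKLExtensiveStepFloor`
(the volume law from any per-link conditional-error floor `v·Z`: `(d·#sites/4)·v²/2 ≤ KL`,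
`τ_int(sign) ≥ e^{KL} − ½`, `1/κ ≥ e^{KL}`, all orientations counted by `Scaling/TorusPlaquetteLastLinks`)
with the floor of `Scaling/AutoregressiveGaugePlaquetteTVFloorAnyLink.wilson_condGap_ge_plaquette_of_mem`:
a conditioner for a link `e` that is blind to the other links at one endpoint of `e` has conditional `L¹`
error `≥ (1/N)∫Re tr ρ(U_p)·F dπ ≥ w·Z` whenever the other three links of a plaquette `p ∋ e` are in its
context (`ρ` with a central scalar `ω ≠ 1`; `w` ANY common lower bound of the plaquette means).  So the law
holds at EVERY coupling with `w = min_p ⟨(1/N)Re tr U_p⟩_{Λ_L,β}` (`> 0` for `β > 0`, `|ω| = 1`,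
`Literature/…/WilsonPlaquettePositivity`) and at weak coupling with the volume-free
`w = f(r) = 1 − 8r²/N + 2log φ_ρ(r)/((d−1)Nβ)` of `Literature/…/WilsonPlaquetteWeakCouplingFloor`.  (The
one-plane count `#sites/3` of the gen-20 draft `…AnyOrder` is superseded by `d/4`: `= 1` in `d = 4`.)

## What is proved (all [ours])

* §1 **`wilson_kl_arHybrid_ge_card_mul_sq_of_last`** — link-indexed loss floor at every coupling: a
  finite set `T` of links of the order, each the last link of a plaquette `P e ∋ e` (other links
  earlier) with `q_e` blind at an endpoint `Y e`; `0 ≤ w ≤ ⟨(1/N)Re tr U_p⟩_β` for every plaquette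
  `p`.  Then `#T·w²/2 ≤ KL(e^{−βS_W}/Z ‖ H_l)`.
* §2 **`wilson_kl_arHybrid_ge_dim_mul_card_site_div_four_mul_sq`** (`d ≥ 2`, `l` a duplicate-free list
  of ALL links, `q_e` blind at an endpoint of every link): `(d·#sites/4)·w²/2 ≤ KL`;
  **`wilson_kl_arHybrid_ge_dim_mul_card_site_div_four`** — the weak-coupling reading with `w = f(r)`
  (unitary `ρ`, `N ≥ 1`, `r > 0`, `f(r) ≥ 0`): `(d·#sites/4)·f(r)²/2 ≤ KL`.
* §3 **`wilson_tauInt_sign_ge_exp_dim_mul_card_site_div_four_mul_sq`**,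
  **`wilson_invKish_ge_exp_dim_mul_card_site_div_four_mul_sq`** — `exp((d·#sites/4)·w²/2) − ½ ≤ τ_int(g)`
  for every measurable balanced sign observable `g` of the exact sampler, and
  `exp((d·#sites/4)·w²/2) ≤ 1/κ`.

READING (value-free): for Wilson lattice gauge theory with any compact group carrying a continuous
representation with a central scalar `ω ≠ 1` (SU(n), U(N), U(1)), any `d ≥ 2`, ANY `β > 0` and any
volume `#sites = L^d`, an exact sampler driven by an autoregressive model — any generation order —
whose conditioner at each link ignores the previously generated links at one endpoint of that link has
training loss `≥ d·L^d·w²/8`, `τ_int ≥ exp(d·L^d·w²/8) − ½` on every balanced sign observable and Kish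
fraction `≤ exp(−d·L^d·w²/8)`, where `w` is the smallest plaquette mean of the target at that coupling
and volume (strictly positive at every `β > 0`; `≥ f(r) → 1` at weak coupling, uniformly in `L`).
NOT CLAIMED: a volume-uniform lower bound on `w` at strong coupling (cluster expansion — not in the
tree); conditioners that read both endpoints; smooth observables; the reverse relative entropy.
No `def`, no `sorry`, nothing cited as a fact beyond the tree.
-/

noncomputable section

namespace Summit.Ventures.LatticeQCDFlow.Theory2.Autoregressive

open MeasureTheory Function Set
open Literature.MathematicalPhysics.QuantumFieldTheory Literature.MathematicalPhysics.QuantumLattice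
open Summit.Ventures.LatticeQCDFlow.Exactness Summit.Ventures.LatticeQCDFlow.Scoring
open scoped Matrix Matrix.Norms.Frobenius

section Wilson

variable {d L N : ℕ} {G : Type*} [Group G] [TopologicalSpace G] [IsTopologicalGroup G]
  [CompactSpace G] [SecondCountableTopology G] [MeasurableSpace G] [BorelSpace G] [NeZero L]
  (ρ : G →* Matrix (Fin N) (Fin N) ℂ)

/-! ## §0 The plaquette-mean floor is a per-link floor -/

/-- **The plaquette mean as a per-link conditional-error floor.**  Continuous `ρ` with a central element
acting by `ω ≠ 1`, `L ≥ 2`, any `β`; `w ≤ ⟨(1/N)Re tr ρ(U_p)⟩_β`; `e` a link of `p`, `s` a set of links off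
`p`; `q ≥ 0` bounded measurable, normalised in `e`, blind to the other links at an endpoint `y` of `e`.
Then `w·Z ≤ ∫ |A_sF − q·A_{insert e s}F| dπ`. [ours] -/
theorem wilson_condGap_ge_floor_mul_of_plaquetteMean (hρ : Continuous ρ) (hL : 2 ≤ L)
    {z : G} {ω : ℂ} (hω : ρ z = ω • (1 : Matrix (Fin N) (Fin N) ℂ)) (hne : ω ≠ 1) {β : ℝ}
    (p : Plaquette d L) {w : ℝ} (hw : w ≤ wilsonExpectation ρ β
      (fun U : GaugeConfig d L G => (N : ℝ)⁻¹ * (ρ (plaquetteHolonomy U p.1 p.2.1.1 p.2.1.2)).trace.re))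
    {e : Edge d L}
    (he : e ∈ ({(p.1, p.2.1.1), (p.1.shift p.2.1.1, p.2.1.2), (p.1.shift p.2.1.2, p.2.1.1), (p.1, p.2.1.2)} :
      Finset (Edge d L)))
    {s : Finset (Edge d L)}
    (hs : s ⊆ Finset.univ \
      {(p.1, p.2.1.1), (p.1.shift p.2.1.1, p.2.1.2), (p.1.shift p.2.1.2, p.2.1.1), (p.1, p.2.1.2)})
    {q : GaugeConfig d L G → ℝ} (hqm : Measurable q) (hq0 : ∀ U, 0 ≤ q U) {Cq : ℝ} (hqb : ∀ U, q U ≤ Cq)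
    (hq1 : ∀ U, ∫ v, q (update U e v) ∂(haarProbability G) = 1)
    {y : Site d L} (hy : e.1 = y ∨ e.1.shift e.2 = y)
    (hqB : ∀ e' : Edge d L, e'.1 = y ∨ e'.1.shift e'.2 = y → e' ≠ e →
      ∀ (U : GaugeConfig d L G) (v : G), q (update U e' v) = q U) :
    w * (∫ W, Real.exp (-β * wilsonAction ρ W) ∂Measure.pi (fun _ : Edge d L => haarProbability G)) ≤
      ∫ U, |coordAvg (haarProbability G) s (fun V : GaugeConfig d L G => Real.exp (-β * wilsonAction ρ V)) U -
          q U * coordAvg (haarProbability G) (insert e s)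
            (fun V : GaugeConfig d L G => Real.exp (-β * wilsonAction ρ V)) U|
        ∂Measure.pi (fun _ : Edge d L => haarProbability G) := by
  set π := Measure.pi (fun _ : Edge d L => haarProbability G) with hπ
  set Z : ℝ := ∫ W, Real.exp (-β * wilsonAction ρ W) ∂π with hZ
  have hZpos : 0 < Z :=
    integral_exp_pos (Literature.Probability.LatticeModels.integrable_of_continuous_compactSpace _
      (Real.continuous_exp.comp (continuous_const.mul (continuous_wilsonAction ρ hρ))))
  have hlin := wilson_condGap_ge_plaquette_of_mem (d := d) (L := L) ρ hρ hL hω hne β p he hs hqm hq0 hqb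
    hq1 hy hqB
  rw [wilsonExpectation_eq_integral_div ρ hρ] at hw
  have hnum : ∫ U, (N : ℝ)⁻¹ * (ρ (plaquetteHolonomy U p.1 p.2.1.1 p.2.1.2)).trace.re *
        Real.exp (-β * wilsonAction ρ U) ∂π =
      (N : ℝ)⁻¹ * ∫ U, (ρ (plaquetteHolonomy U p.1 p.2.1.1 p.2.1.2)).trace.re *
        Real.exp (-β * wilsonAction ρ U) ∂π := by
    rw [← integral_const_mul]
    refine integral_congr_ae (ae_of_all _ fun U => ?_)
    ring
  rw [hnum] at hw
  have hwZ := (le_div_iff₀ hZpos).1 hw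
  exact hwZ.trans hlin

/-! ## §1 The loss floor indexed by links, at every coupling -/

/-- **The loss floor, link-indexed, at every coupling.**  Continuous `ρ` with a central element acting
by `ω ≠ 1`; `L ≥ 2`; any `β`; `0 ≤ w ≤ ⟨(1/N)Re tr U_p⟩_β` for every plaquette `p`; an
autoregressive block `l` (duplicate-free, squeezed normalised conditionals not reading later links); a
finite set `T` of links of `l`, each `e ∈ T` the last link of a plaquette `P e ∋ e` (all other links of
`P e` come EARLIER in `l`) with `q_e` blind at an endpoint `Y e` of `e`.  Then `#T·w²/2 ≤ KL`. [ours] -/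
theorem wilson_kl_arHybrid_ge_card_mul_sq_of_last (hρ : Continuous ρ) (hL : 2 ≤ L)
    {z : G} {ω : ℂ} (hω : ρ z = ω • (1 : Matrix (Fin N) (Fin N) ℂ)) (hne : ω ≠ 1) {β : ℝ}
    {w : ℝ} (hw0 : 0 ≤ w) (hw : ∀ p : Plaquette d L, w ≤ wilsonExpectation ρ β
      (fun U : GaugeConfig d L G => (N : ℝ)⁻¹ * (ρ (plaquetteHolonomy U p.1 p.2.1.1 p.2.1.2)).trace.re))
    {q : Edge d L → GaugeConfig d L G → ℝ} (hqm : ∀ a, Measurable (q a)) {cq Cq : ℝ} (hcq : 0 < cq)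
    (hqlo : ∀ a U, cq ≤ q a U) (hqhi : ∀ a U, q a U ≤ Cq)
    (hq1 : ∀ a U, ∫ v, q a (update U a v) ∂(haarProbability G) = 1)
    (l : List (Edge d L)) (hl : l.Nodup)
    (hpw : l.Pairwise (fun a b => ∀ (U : GaugeConfig d L G) (v : G), q a (update U b v) = q a U))
    (T : Finset (Edge d L)) (hT : ∀ e ∈ T, e ∈ l)
    (P : Edge d L → Plaquette d L) (Y : Edge d L → Site d L)
    (hP : ∀ e ∈ T, e ∈ ({((P e).1, (P e).2.1.1), ((P e).1.shift (P e).2.1.1, (P e).2.1.2),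
        ((P e).1.shift (P e).2.1.2, (P e).2.1.1), ((P e).1, (P e).2.1.2)} : Finset (Edge d L)))
    (hbefore : ∀ e ∈ T, ∀ e' ∈ ({((P e).1, (P e).2.1.1), ((P e).1.shift (P e).2.1.1, (P e).2.1.2),
        ((P e).1.shift (P e).2.1.2, (P e).2.1.1), ((P e).1, (P e).2.1.2)} : Finset (Edge d L)),
        e' ≠ e → l.idxOf e' < l.idxOf e)
    (hY : ∀ e ∈ T, e.1 = Y e ∨ e.1.shift e.2 = Y e)
    (hqB : ∀ e ∈ T, ∀ e' : Edge d L, e'.1 = Y e ∨ e'.1.shift e'.2 = Y e → e' ≠ e →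
      ∀ (U : GaugeConfig d L G) (v : G), q e (update U e' v) = q e U) :
    (T.card : ℝ) * w ^ 2 / 2 ≤
      ∫ U, Real.exp (-β * wilsonAction ρ U) /
            (∫ W, Real.exp (-β * wilsonAction ρ W) ∂Measure.pi (fun _ : Edge d L => haarProbability G)) *
          Real.log ((Real.exp (-β * wilsonAction ρ U) /
              ∫ W, Real.exp (-β * wilsonAction ρ W) ∂Measure.pi (fun _ : Edge d L => haarProbability G)) /
            ((l.map fun b => q b U).prod *
                coordAvg (haarProbability G) l.toFinset
                  (fun V : GaugeConfig d L G => Real.exp (-β * wilsonAction ρ V)) U /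
              ∫ W, Real.exp (-β * wilsonAction ρ W) ∂Measure.pi (fun _ : Edge d L => haarProbability G)))
        ∂Measure.pi (fun _ : Edge d L => haarProbability G) := by
  have hq0 : ∀ a U, 0 ≤ q a U := fun a U => hcq.le.trans (hqlo a U)
  exact wilson_kl_arHybrid_ge_card_mul_sq_of_lastFloor (d := d) (L := L) ρ hρ β hqm hcq hqlo hqhi hq1 l hl
    hpw T hT P hbefore hw0 (fun e he s hs =>
      wilson_condGap_ge_floor_mul_of_plaquetteMean (d := d) (L := L) ρ hρ hL hω hne (P e) (hw (P e))
        (hP e he) hs (hqm e) (hq0 e) (hqhi e) (hq1 e) (hY e he) (hqB e he))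

/-! ## §2 The volume law for the training loss -/

/-- **THE VOLUME LAW FOR THE TRAINING LOSS AT EVERY COUPLING, ALL ORIENTATIONS.**  `d ≥ 2`; hypotheses of
`wilson_kl_arHybrid_ge_card_mul_sq_of_last` on `ρ`, `β`, `w`, `q`; `l` a duplicate-free list of ALL links
(any generation order); for EVERY link `e` an endpoint `Y e` such that `q_e` ignores every other link at
`Y e`.  Then `(d·#sites/4)·w²/2 ≤ KL(e^{−βS_W}/Z ‖ H_l)`. [ours] -/
theorem wilson_kl_arHybrid_ge_dim_mul_card_site_div_four_mul_sq (hd : 2 ≤ d)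
    (hρ : Continuous ρ) (hL : 2 ≤ L)
    {z : G} {ω : ℂ} (hω : ρ z = ω • (1 : Matrix (Fin N) (Fin N) ℂ)) (hne : ω ≠ 1) {β : ℝ}
    {w : ℝ} (hw0 : 0 ≤ w) (hw : ∀ p : Plaquette d L, w ≤ wilsonExpectation ρ β
      (fun U : GaugeConfig d L G => (N : ℝ)⁻¹ * (ρ (plaquetteHolonomy U p.1 p.2.1.1 p.2.1.2)).trace.re))
    {q : Edge d L → GaugeConfig d L G → ℝ} (hqm : ∀ a, Measurable (q a)) {cq Cq : ℝ} (hcq : 0 < cq)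
    (hqlo : ∀ a U, cq ≤ q a U) (hqhi : ∀ a U, q a U ≤ Cq)
    (hq1 : ∀ a U, ∫ v, q a (update U a v) ∂(haarProbability G) = 1)
    (l : List (Edge d L)) (hl : l.Nodup) (hall : ∀ e : Edge d L, e ∈ l)
    (hpw : l.Pairwise (fun a b => ∀ (U : GaugeConfig d L G) (v : G), q a (update U b v) = q a U))
    (Y : Edge d L → Site d L) (hY : ∀ e : Edge d L, e.1 = Y e ∨ e.1.shift e.2 = Y e)
    (hqB : ∀ e e' : Edge d L, e'.1 = Y e ∨ e'.1.shift e'.2 = Y e → e' ≠ e →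
      ∀ (U : GaugeConfig d L G) (v : G), q e (update U e' v) = q e U) :
    (d : ℝ) * Fintype.card (Site d L) / 4 * w ^ 2 / 2 ≤
      ∫ U, Real.exp (-β * wilsonAction ρ U) /
            (∫ W, Real.exp (-β * wilsonAction ρ W) ∂Measure.pi (fun _ : Edge d L => haarProbability G)) *
          Real.log ((Real.exp (-β * wilsonAction ρ U) /
              ∫ W, Real.exp (-β * wilsonAction ρ W) ∂Measure.pi (fun _ : Edge d L => haarProbability G)) /
            ((l.map fun b => q b U).prod *
                coordAvg (haarProbability G) l.toFinset
                  (fun V : GaugeConfig d L G => Real.exp (-β * wilsonAction ρ V)) U /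
              ∫ W, Real.exp (-β * wilsonAction ρ W) ∂Measure.pi (fun _ : Edge d L => haarProbability G)))
        ∂Measure.pi (fun _ : Edge d L => haarProbability G) := by
  have hq0 : ∀ a U, 0 ≤ q a U := fun a U => hcq.le.trans (hqlo a U)
  exact wilson_kl_arHybrid_ge_dim_mul_card_site_div_four_mul_sq_of_floor (d := d) (L := L) ρ hd hρ β hqm hcq
    hqlo hqhi hq1 l hl hall hpw hw0 (fun p e he s hs =>
      wilson_condGap_ge_floor_mul_of_plaquetteMean (d := d) (L := L) ρ hρ hL hω hne p (hw p) he hs (hqm e)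
        (hq0 e) (hqhi e) (hq1 e) (hY e) (hqB e))

/-- **The weak-coupling reading, volume-free rate.**  `d ≥ 2`, `N ≥ 1`, unitary continuous `ρ` with a
central scalar `ω ≠ 1`, `β > 0`, `r > 0` with `f(r) = 1 − 8r²/N + 2log φ_ρ(r)/((d−1)Nβ) ≥ 0`
(`φ_ρ(r) = Haar{‖ρ(g) − 1‖ ≤ r}`); `l`, `q`, `Y` as above.  Then `(d·#sites/4)·f(r)²/2 ≤ KL` — in
`d = 4`, `L^4·f(r)²/2` nats. [ours] -/
theorem wilson_kl_arHybrid_ge_dim_mul_card_site_div_four (hd : 2 ≤ d) (hN : 1 ≤ N)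
    (hρ : Continuous ρ) (hρU : ∀ g, ρ g ∈ Matrix.unitaryGroup (Fin N) ℂ) (hL : 2 ≤ L)
    {z : G} {ω : ℂ} (hω : ρ z = ω • (1 : Matrix (Fin N) (Fin N) ℂ)) (hne : ω ≠ 1)
    {β : ℝ} (hβ : 0 < β) {r : ℝ} (hr : 0 < r)
    (hf : 0 ≤ (1 - 8 * r ^ 2 / N +
        2 * Real.log ((haarProbability G).real {g : G | ‖ρ g - 1‖ ≤ r}) / (((d : ℝ) - 1) * N * β)))
    {q : Edge d L → GaugeConfig d L G → ℝ} (hqm : ∀ a, Measurable (q a)) {cq Cq : ℝ} (hcq : 0 < cq)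
    (hqlo : ∀ a U, cq ≤ q a U) (hqhi : ∀ a U, q a U ≤ Cq)
    (hq1 : ∀ a U, ∫ v, q a (update U a v) ∂(haarProbability G) = 1)
    (l : List (Edge d L)) (hl : l.Nodup) (hall : ∀ e : Edge d L, e ∈ l)
    (hpw : l.Pairwise (fun a b => ∀ (U : GaugeConfig d L G) (v : G), q a (update U b v) = q a U))
    (Y : Edge d L → Site d L) (hY : ∀ e : Edge d L, e.1 = Y e ∨ e.1.shift e.2 = Y e)
    (hqB : ∀ e e' : Edge d L, e'.1 = Y e ∨ e'.1.shift e'.2 = Y e → e' ≠ e →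
      ∀ (U : GaugeConfig d L G) (v : G), q e (update U e' v) = q e U) :
    (d : ℝ) * Fintype.card (Site d L) / 4 * (1 - 8 * r ^ 2 / N +
        2 * Real.log ((haarProbability G).real {g : G | ‖ρ g - 1‖ ≤ r}) / (((d : ℝ) - 1) * N * β)) ^ 2 / 2 ≤
      ∫ U, Real.exp (-β * wilsonAction ρ U) /
            (∫ W, Real.exp (-β * wilsonAction ρ W) ∂Measure.pi (fun _ : Edge d L => haarProbability G)) *
          Real.log ((Real.exp (-β * wilsonAction ρ U) /
              ∫ W, Real.exp (-β * wilsonAction ρ W) ∂Measure.pi (fun _ : Edge d L => haarProbability G)) /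
            ((l.map fun b => q b U).prod *
                coordAvg (haarProbability G) l.toFinset
                  (fun V : GaugeConfig d L G => Real.exp (-β * wilsonAction ρ V)) U /
              ∫ W, Real.exp (-β * wilsonAction ρ W) ∂Measure.pi (fun _ : Edge d L => haarProbability G)))
        ∂Measure.pi (fun _ : Edge d L => haarProbability G) :=
  wilson_kl_arHybrid_ge_dim_mul_card_site_div_four_mul_sq (d := d) (L := L) ρ hd hρ hL hω hne hf
    (fun p => wilsonExpectation_plaquette_ge_linkBall (d := d) (L := L) ρ hd hN hρ hρU hβ hr p.1
      (ne_of_lt p.2.2))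
    hqm hcq hqlo hqhi hq1 l hl hall hpw Y hY hqB

/-! ## §3 Exponential slowing down in the volume, at every coupling -/

/-- **`τ_int(g) ≥ exp((d·#sites/4)·w²/2) − ½`** for every measurable balanced sign observable `g` of the
exact independence sampler with target `e^{−βS_W}/Z` and an autoregressive proposal — any generation
order of all links — whose every conditional ignores the links at one endpoint of its link; `w ≥ 0` any
common lower bound of the plaquette means (hypotheses of
`wilson_kl_arHybrid_ge_dim_mul_card_site_div_four_mul_sq`). [ours] -/
theorem wilson_tauInt_sign_ge_exp_dim_mul_card_site_div_four_mul_sq (hd : 2 ≤ d)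
    (hρ : Continuous ρ) (hL : 2 ≤ L)
    {z : G} {ω : ℂ} (hω : ρ z = ω • (1 : Matrix (Fin N) (Fin N) ℂ)) (hne : ω ≠ 1) {β : ℝ}
    {w : ℝ} (hw0 : 0 ≤ w) (hw : ∀ p : Plaquette d L, w ≤ wilsonExpectation ρ β
      (fun U : GaugeConfig d L G => (N : ℝ)⁻¹ * (ρ (plaquetteHolonomy U p.1 p.2.1.1 p.2.1.2)).trace.re))
    {q : Edge d L → GaugeConfig d L G → ℝ} (hqm : ∀ a, Measurable (q a)) {cq Cq : ℝ} (hcq : 0 < cq)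
    (hqlo : ∀ a U, cq ≤ q a U) (hqhi : ∀ a U, q a U ≤ Cq)
    (hq1 : ∀ a U, ∫ v, q a (update U a v) ∂(haarProbability G) = 1)
    (l : List (Edge d L)) (hl : l.Nodup) (hall : ∀ e : Edge d L, e ∈ l)
    (hpw : l.Pairwise (fun a b => ∀ (U : GaugeConfig d L G) (v : G), q a (update U b v) = q a U))
    (Y : Edge d L → Site d L) (hY : ∀ e : Edge d L, e.1 = Y e ∨ e.1.shift e.2 = Y e)
    (hqB : ∀ e e' : Edge d L, e'.1 = Y e ∨ e'.1.shift e'.2 = Y e → e' ≠ e →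
      ∀ (U : GaugeConfig d L G) (v : G), q e (update U e' v) = q e U)
    {g : GaugeConfig d L G → ℝ} (hgm : Measurable g) (hg1 : ∀ U, g U ^ 2 = 1)
    (hg0 : ∫ U, g U * Real.exp (-β * wilsonAction ρ U) ∂Measure.pi (fun _ : Edge d L => haarProbability G) = 0) :
    Real.exp ((d : ℝ) * Fintype.card (Site d L) / 4 * w ^ 2 / 2) - 1 / 2 ≤
      tauInt (fun k => (∫ U, g U * ((imhOp (Measure.pi fun _ : Edge d L => haarProbability G)
          (fun V : GaugeConfig d L G => Real.exp (-β * wilsonAction ρ V))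
          (fun V : GaugeConfig d L G => (l.map fun b => q b V).prod *
              coordAvg (haarProbability G) l.toFinset
                (fun V' : GaugeConfig d L G => Real.exp (-β * wilsonAction ρ V')) V /
            ∫ W, Real.exp (-β * wilsonAction ρ W) ∂Measure.pi (fun _ : Edge d L => haarProbability G)))^[k]
            g) U * Real.exp (-β * wilsonAction ρ U) ∂Measure.pi (fun _ : Edge d L => haarProbability G)) /
          ∫ U, g U ^ 2 * Real.exp (-β * wilsonAction ρ U) ∂Measure.pi (fun _ : Edge d L => haarProbability G)) := by
  have hq0 : ∀ a U, 0 ≤ q a U := fun a U => hcq.le.trans (hqlo a U)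
  exact wilson_tauInt_sign_ge_exp_of_floor (d := d) (L := L) ρ hd hρ β hqm hcq hqlo hqhi hq1 l hl hall hpw hw0
    (fun p e he s hs =>
      wilson_condGap_ge_floor_mul_of_plaquetteMean (d := d) (L := L) ρ hρ hL hω hne p (hw p) he hs (hqm e)
        (hq0 e) (hqhi e) (hq1 e) (hY e) (hqB e)) hgm hg1 hg0

/-- **`1/κ ≥ exp((d·#sites/4)·w²/2)`** — the Kish effective-sample-size fraction of the reweighting
estimator built on such a model is at most `exp(−(d·#sites/4)·w²/2)`, at every coupling. [ours] -/
theorem wilson_invKish_ge_exp_dim_mul_card_site_div_four_mul_sq (hd : 2 ≤ d)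
    (hρ : Continuous ρ) (hL : 2 ≤ L)
    {z : G} {ω : ℂ} (hω : ρ z = ω • (1 : Matrix (Fin N) (Fin N) ℂ)) (hne : ω ≠ 1) {β : ℝ}
    {w : ℝ} (hw0 : 0 ≤ w) (hw : ∀ p : Plaquette d L, w ≤ wilsonExpectation ρ β
      (fun U : GaugeConfig d L G => (N : ℝ)⁻¹ * (ρ (plaquetteHolonomy U p.1 p.2.1.1 p.2.1.2)).trace.re))
    {q : Edge d L → GaugeConfig d L G → ℝ} (hqm : ∀ a, Measurable (q a)) {cq Cq : ℝ} (hcq : 0 < cq)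
    (hqlo : ∀ a U, cq ≤ q a U) (hqhi : ∀ a U, q a U ≤ Cq)
    (hq1 : ∀ a U, ∫ v, q a (update U a v) ∂(haarProbability G) = 1)
    (l : List (Edge d L)) (hl : l.Nodup) (hall : ∀ e : Edge d L, e ∈ l)
    (hpw : l.Pairwise (fun a b => ∀ (U : GaugeConfig d L G) (v : G), q a (update U b v) = q a U))
    (Y : Edge d L → Site d L) (hY : ∀ e : Edge d L, e.1 = Y e ∨ e.1.shift e.2 = Y e)
    (hqB : ∀ e e' : Edge d L, e'.1 = Y e ∨ e'.1.shift e'.2 = Y e → e' ≠ e →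
      ∀ (U : GaugeConfig d L G) (v : G), q e (update U e' v) = q e U) :
    Real.exp ((d : ℝ) * Fintype.card (Site d L) / 4 * w ^ 2 / 2) ≤
      (∫ U, Real.exp (-β * wilsonAction ρ U) /
            ((l.map fun b => q b U).prod *
                coordAvg (haarProbability G) l.toFinset
                  (fun V : GaugeConfig d L G => Real.exp (-β * wilsonAction ρ V)) U /
              ∫ W, Real.exp (-β * wilsonAction ρ W) ∂Measure.pi (fun _ : Edge d L => haarProbability G)) *
          Real.exp (-β * wilsonAction ρ U) ∂Measure.pi (fun _ : Edge d L => haarProbability G)) /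
        (∫ W, Real.exp (-β * wilsonAction ρ W) ∂Measure.pi (fun _ : Edge d L => haarProbability G)) ^ 2 := by
  have hq0 : ∀ a U, 0 ≤ q a U := fun a U => hcq.le.trans (hqlo a U)
  exact wilson_invKish_ge_exp_of_floor (d := d) (L := L) ρ hd hρ β hqm hcq hqlo hqhi hq1 l hl hall hpw hw0
    (fun p e he s hs =>
      wilson_condGap_ge_floor_mul_of_plaquetteMean (d := d) (L := L) ρ hρ hL hω hne p (hw p) he hs (hqm e)
        (hq0 e) (hqhi e) (hq1 e) (hY e) (hqB e))

end Wilson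

end Summit.Ventures.LatticeQCDFlow.Theory2.Autoregressive

end
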